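/-
Copyright (c) 2026. All rights reserved.
Released under Apache 2.0 license as described in the file LICENSE.
Authors: abc-iut cell, seat abc-iut-L6-t6 (units at every place of abc-iut-L6-d1's model are roots of unity;
input of the perfection-uniqueness sentence of [IUTchIII] Example 3.6 (iii) at the model).
-/
import Literature.IUT.LogThetaLattice.GlobalFrobenioidModelsPlaces
import Mathlib.NumberTheory.NumberField.InfinitePlace.Embeddings
import Mathlib.GroupTheory.OrderOfElement
import HarnessLib

/-!
# [IUTchIII] Example 3.6 / Remark 3.6.1 at the model: an element of `F^×_mod` that is a unit at EVERY
# place (`β_v(u) = 0` for all `v ∈ 𝕍`) is a root of unity (Kronecker) — proof-only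

S. Mochizuki, *Inter-universal Teichmüller Theory III*, kurims manuscript (May 2020), Example 3.6 (iii) p. 108
l. 22–27 and Remark 3.6.1 p. 108 [claim key Mochizuki2012, status disputed (D-0012)]. The last sentence of
Ex. 3.6 (iii) ("the induced isomorphism between the respective perfections … is completely determined by
[inducing the identity on `F^×_mod`]") rests, at the level of THE perfection, on the fact that the only
ambiguity of an isomorphism of Frobenioids compatible with the Frobenioid structures — a twist by elements of
`F^×_mod` of zero divisor, i.e. by units at every place — is TORSION (abc-iut-L6-t6,
`GlobalFrobenioidModelsPerfectionRigidity.lean`: torsion discrepancies die in the perfection). For the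
tree's MODEL of the places of a number field (abc-iut-L6-d1, `GlobalFrobenioidModelsPlaces.lean`: all places,
`β_v = ord_v` at finite `v`, `β_v = −log|·|_v` at archimedean `v`, `Γ_v = ℝ`) this file proves that fact with
no hypothesis, from Mathlib's Kronecker theorem (`NumberField.Embeddings.pow_eq_one_of_norm_eq_one`):
* `valuation_eq_one_of_betaFin_eq_zero` — `β_w(u) = 0` at a finite place means `w(u) = 1`;
* `infinitePlace_eq_one_of_betaInf_eq_zero` — `β_v(u) = 0` at an archimedean place means `|u|_v = 1`;
* **`isOfFinOrder_of_betaModel_eq_zero`** — if `β_v(u) = 0` for every `v ∈ 𝕍` then `u ∈ F^×_mod` has finite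
  order (it is an algebraic integer all of whose conjugates have absolute value `1`);
* `betaModel_eq_zero_of_isOfFinOrder` — conversely roots of unity are units at every place (`ℝ` is
  torsion-free), e.g. `u = −1` (`betaModel_neg_one`, with `neg_one_ne_one_units`).
Classical algebraic number theory; nothing here bears on [IUTchIII] Cor. 3.12; typed ≠ endorsed.
-/

namespace Literature.IUT.LogThetaLattice

namespace GlobalFrobenioidModels

open NumberField IsDedekindDomain

universe u

variable {K : Type u} [Field K] [NumberField K]

/-- `β_w(u) = 0` at a finite place `w` means `w(u) = 1` for the `w`-adic valuation.
([IUTchIII] Rmk 3.6.1 p.108) [claim: Mochizuki2012, status: disputed] -/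
theorem valuation_eq_one_of_betaFin_eq_zero (w : HeightOneSpectrum (𝓞 K)) {u : Kˣ}
    (h : betaFin w (Additive.ofMul u) = 0) : w.valuation K (u : K) = 1 := by
  rw [betaFin, AddMonoidHom.neg_apply, neg_eq_zero, AddMonoidHom.coe_comp, Function.comp_apply,
    MonoidHom.coe_toAdditiveLeft, Function.comp_apply, Function.comp_apply, toMul_ofMul, Int.coe_castAddHom,
    Int.cast_eq_zero, toAdd_eq_zero] at h
  rw [← HeightOneSpectrum.valuationOfNeZero_eq, h, WithZero.coe_one]

omit [NumberField K] in
/-- `β_v(u) = 0` at an archimedean place `v` means `|u|_v = 1`. ([IUTchIII] Rmk 3.6.1 p.108) [claim: Mochizuki2012, status: disputed] -/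
theorem infinitePlace_eq_one_of_betaInf_eq_zero (v : InfinitePlace K) {u : Kˣ}
    (h : betaInf v (Additive.ofMul u) = 0) : v (u : K) = 1 := by
  change -Real.log (v ((Additive.toMul (Additive.ofMul u) : Kˣ) : K)) = 0 at h
  rw [toMul_ofMul, neg_eq_zero, Real.log_eq_zero] at h
  have hpos : 0 < v (u : K) := v.pos_iff.mpr (Units.ne_zero u)
  rcases h with h | h | h
  · exact absurd h hpos.ne'
  · exact h
  · exfalso
    linarith

/-- A unit at every finite place is an algebraic integer. ([IUTchIII] Rmk 3.6.1 p.108) [claim: Mochizuki2012, status: disputed] -/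
theorem isIntegral_of_betaFin_eq_zero {u : Kˣ}
    (h : ∀ w : HeightOneSpectrum (𝓞 K), betaFin w (Additive.ofMul u) = 0) : IsIntegral ℤ (u : K) := by
  obtain ⟨y, hy⟩ := HeightOneSpectrum.mem_integers_of_valuation_le_one K (u : K)
    fun w => (valuation_eq_one_of_betaFin_eq_zero w (h w)).le
  rw [← hy]
  exact y.isIntegral_coe

/-- **Units at every place of `F_mod` are roots of unity (Kronecker)**: if `β_v(u) = 0` for every place
`v ∈ 𝕍` of the model, then `u ∈ F^×_mod` has finite order. ([IUTchIII] Rmk 3.6.1 p.108) [claim: Mochizuki2012, status: disputed] -/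
theorem isOfFinOrder_of_betaModel_eq_zero (u : Kˣ) (h : ∀ v : ModelPlaces K, betaModel v (Additive.ofMul u) = 0) :
    IsOfFinOrder u := by
  have hi : IsIntegral ℤ (u : K) := isIntegral_of_betaFin_eq_zero fun w => h (Sum.inl w)
  have hnorm : ∀ φ : K →+* ℂ, ‖φ (u : K)‖ = 1 := fun φ => by
    rw [← InfinitePlace.apply]
    exact infinitePlace_eq_one_of_betaInf_eq_zero (InfinitePlace.mk φ) (h (Sum.inr (InfinitePlace.mk φ)))
  obtain ⟨n, hn, hun⟩ := Embeddings.pow_eq_one_of_norm_eq_one K ℂ hi hnorm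
  exact isOfFinOrder_iff_pow_eq_one.mpr ⟨n, hn, Units.ext (by rw [Units.val_pow_eq_pow_val, hun, Units.val_one])⟩

/-- The subgroup `⋂_v ker β_v` of units at every place is contained in the torsion of `F^×_mod`.
([IUTchIII] Rmk 3.6.1 p.108) [claim: Mochizuki2012, status: disputed] -/
theorem isOfFinOrder_div_of_betaModel_eq {f g : Kˣ}
    (h : ∀ v : ModelPlaces K, betaModel v (Additive.ofMul f) = betaModel v (Additive.ofMul g)) :
    IsOfFinOrder (f / g) :=
  isOfFinOrder_of_betaModel_eq_zero (f / g) fun v => by rw [ofMul_div, map_sub, h v, sub_self]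

/-- Conversely, a root of unity is a unit at every place of the model (`Γ_v = ℝ` is torsion-free).
([IUTchIII] Rmk 3.6.1 p.108) [claim: Mochizuki2012, status: disputed] -/
theorem betaModel_eq_zero_of_isOfFinOrder {u : Kˣ} (hu : IsOfFinOrder u) (v : ModelPlaces K) :
    betaModel v (Additive.ofMul u) = 0 := by
  obtain ⟨k, hk, h⟩ := isOfFinOrder_iff_pow_eq_one.mp hu
  have e : k • betaModel v (Additive.ofMul u) = 0 := by
    rw [← map_nsmul, ← ofMul_pow, h, ofMul_one, map_zero]
  rcases smul_eq_zero.mp e with h0 | h0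
  · exact absurd h0 hk.ne'
  · exact h0

omit [NumberField K] in
/-- `−1 ∈ F^×_mod` has finite order. ([IUTchIII] Rmk 3.6.1 p.108) [claim: Mochizuki2012, status: disputed] -/
theorem isOfFinOrder_neg_one_units : IsOfFinOrder (-1 : Kˣ) :=
  isOfFinOrder_iff_pow_eq_one.mpr ⟨2, two_pos, by rw [neg_one_sq]⟩

/-- `−1` is a unit at every place of the model. ([IUTchIII] Rmk 3.6.1 p.108) [claim: Mochizuki2012, status: disputed] -/
theorem betaModel_neg_one (v : ModelPlaces K) : betaModel v (Additive.ofMul (-1 : Kˣ)) = 0 :=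
  betaModel_eq_zero_of_isOfFinOrder isOfFinOrder_neg_one_units v

/-- `−1 ≠ 1` in `F^×_mod` (characteristic `0`). ([IUTchIII] Ex 3.6 (iii) p.108) [claim: Mochizuki2012, status: disputed] -/
theorem neg_one_ne_one_units : (-1 : Kˣ) ≠ 1 := by
  intro h
  have h' : ((-1 : Kˣ) : K) = ((1 : Kˣ) : K) := by rw [h]
  rw [Units.val_neg, Units.val_one] at h'
  exact (two_ne_zero : (2 : K) ≠ 0) (by linear_combination (-1 : K) * h')

end GlobalFrobenioidModels

end Literature.IUT.LogThetaLattice
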